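import Summits.AnomalousDissipation.AnomalousDissipation.Theorems.SolenoidalFractalHomogenisationLagrangianStepFlatBilinearWindow
import Summits.AnomalousDissipation.AnomalousDissipation.Theorems.SolenoidalFractalHomogenisationLagrangianStepFlatBilinearBookkeeping
import Summits.AnomalousDissipation.AnomalousDissipation.Theorems.SolenoidalFractalHomogenisationLagrangianStepOneLevelSplitApi
import HarnessLib

/-!
# K1L_D (stmt-AnomalousDissipation-27980), line «onelevel-design»: **brick Z4♭ `flatBilinearSlow_text` PROVED** — the FLAT slow×slow core of the
# bilinear cut (BIL) of `stub_cellInputs`, i.e. the slow-vector clause (V) read on one grid window (helper; `--supports … --as helper`; lead g4)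

The text `flatBilinearSlow_text` of `Cruxes/LagrangianRenormalisationStep/Lines/onelevel_Z_bricks.lean` v5 VERBATIM (`flatBilinearSlow`): for every
design, gain and cell package with (V) `SlowVectorClauseF`, there are `ν₁ K₁ Λ₀ θ₀ Cz σz` such that for every `LPermissible` carrier in the template of
the registered texts, every level `m`, the pinned trim level `Lc`, every window shape, the FLAT pair of propagators (`Um` carrier-free effective,
`Um1` along the Eulerian lattice level), every grid window `[jr, s']` and all `S`-supported `x, y ∈ V2` (`S = freqBall(Lc/2)∖{0}`):
`|⟪Um1 (jr) s' x − Um (jr) s' x, y⟫| ≤ ηz·√(Σ_S min(1, rate τ)‖𝓕x‖²)·√(Σ_S min(1, rate τ)‖𝓕y‖²)`, `ηz = Cz ρ^σz`.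
Witnesses: `ν₁ = ν₀`, `K₁ = θ₀ = 1`, `Λ₀ = ⌈((K+ν₀)/√c + 2)^64⌉₊ + 1` (so that `ρ ≤ 1/Λ₀` forces `Lc < N(m+1)` and `(Lc/2)⌈K/ν⌉ ≤ N(m+1)`),
`σz = min(σ,2)/64`, `Cz = 2√2·CZ + 1` with the `CZ` of `…FlatBilinearBookkeeping.errBound_le`; `m⋆ = 0`.
Proof = `…FlatBilinearWindow.abs_inner_window_sub_le_sum` (the window bound in (V)'s currency) + `errBound_le` (template bookkeeping:
(T1) `ρ ≤ 1/Λ₀`, (T2) `ν ≤ ρ^{1/4}`, (T5) `physPeriod ≤ ρ^{1/16}·refresh`, `Permissible` (5) `cellVisc < nu0 ≤ ν₀`) + Cauchy–Schwarz.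
This is the θ = 0 (no coarse flow) model of §9z (BIL); the frame/distortion steps Z5–Z7 of memo L8 remain.  NOT a proof of §9z, of any registered
stub, of the crux, or of AD; rung F-D1.A0.
-/

set_option linter.dupNamespace false  -- the summit-side namespace `Summit.AnomalousDissipation.AnomalousDissipation.…` repeats a component by design (D-0017)

noncomputable section

namespace Summit.AnomalousDissipation.AnomalousDissipation.Theorems.SolenoidalFractalHomogenisation.LagrangianStep.FlatWindow

open Literature.Analysis Literature.Analysis.FluidPDE Literature.Analysis.FluidPDE.Torus Literature.Analysis.FunctionSpaces
open MeasureTheory Set Filter UnitAddTorus Function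
open scoped ENNReal NNReal InnerProductSpace
open OneLevelSplit
open Literature.Analysis.FluidPDE.LatticeShear (LagrangianLatticeCarrier LatticeWord)
open Summit.AnomalousDissipation.AnomalousDissipation.Theorems.SolenoidalFractalHomogenisation.LagrangianRenormalisationStep (cellVisc_pos')

/-- Weighted Cauchy–Schwarz: `Σ η d a b ≤ η √(Σ d a²) √(Σ d b²)` for `η, d ≥ 0`. -/
theorem sum_weight_mul_le_sqrt (S : Finset (Fin 3 → ℤ)) (d a b : (Fin 3 → ℤ) → ℝ) (η : ℝ) (hη : 0 ≤ η) (hd : ∀ k, 0 ≤ d k) :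
    ∑ k ∈ S, η * d k * a k * b k ≤ η * Real.sqrt (∑ k ∈ S, d k * a k ^ 2) * Real.sqrt (∑ k ∈ S, d k * b k ^ 2) := by
  have e : ∑ k ∈ S, η * d k * a k * b k = η * ∑ k ∈ S, (Real.sqrt (d k) * a k) * (Real.sqrt (d k) * b k) := by
    rw [Finset.mul_sum]
    refine Finset.sum_congr rfl fun k _ => ?_
    have hdd : Real.sqrt (d k) * Real.sqrt (d k) = d k := Real.mul_self_sqrt (hd k)
    calc η * d k * a k * b k = η * ((Real.sqrt (d k) * Real.sqrt (d k)) * a k * b k) := by rw [hdd]; ring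
      _ = η * (Real.sqrt (d k) * a k * (Real.sqrt (d k) * b k)) := by ring
  rw [e, mul_assoc]
  refine mul_le_mul_of_nonneg_left ?_ hη
  refine (Real.sum_mul_le_sqrt_mul_sqrt S _ _).trans (le_of_eq ?_)
  congr 1 <;> (congr 1; refine Finset.sum_congr rfl fun k _ => ?_; rw [mul_pow, Real.sq_sqrt (hd k)])

set_option maxHeartbeats 1600000 in
/-- **Z4♭ `flatBilinearSlow_text` (Z-bricks v5), PROVED.**  See the module docstring. -/
theorem flatBilinearSlow : ∀ k (W : Literature.Analysis.FluidPDE.LatticeShear.LatticeWord k) (M : ℝ) (hM : 0 < M) (c : ℝ), 0 < c →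
    ∀ (Φ : ℝ → Torus.Visc4 (Fin 3) → Torus.Visc4 (Fin 3)) (lo hi Λ β σ C ν₀ K : ℝ),
      0 < lo → lo ≤ 1 → 1 ≤ hi → 1 < Λ → 0 ≤ β →
      0 < σ → 0 ≤ C → 0 < ν₀ → 0 < K → SlowVectorClauseF W M hM c Φ lo hi Λ β σ C ν₀ K →
      ∃ ν₁ > (0:ℝ), ∃ K₁ > (0:ℝ), ∃ Λ₀ : ℕ, ∃ θ₀ > (0:ℝ), ∃ Cz > (0:ℝ), ∃ σz > (0:ℝ),
        ∀ E : Literature.Analysis.FluidPDE.LatticeShear.LagrangianLatticeCarrier k, E.design = W.stretch M hM → E.gain = c → E.nu0 ≤ ν₁ → K₁ ≤ E.K →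
          E.LPermissible → (∀ m, Λ₀ * E.N m ≤ E.N (m + 1)) → (∀ m, E.N m ^ 2 ≤ E.N (m + 1)) →
          (∀ m, E.cellVisc (m + 1) * ((E.N (m + 1) : ℝ) / E.N m) ^ (1 / 4 : ℝ) ≤ 1) →
          (∀ m, E.K * ((E.N (m + 1) : ℝ) / E.N m) ^ (1 / 4 : ℝ) ≤ ((E.N (m + 1) : ℝ) / E.N m) * E.cellVisc (m + 1)) →
          (∀ m, E.θ (m + 1) * ((E.N (m + 1) : ℝ) / E.N m) ^ (1 / 16 : ℝ) ≤ θ₀) →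
          (∀ m, ((E.N (m + 1) : ℝ) / E.N m) ^ (1 / 16 : ℝ) * E.physPeriod (m + 1) ≤ E.refresh (m + 1)) →
        ∃ mstar : ℕ, ∀ m, mstar ≤ m →
          ∀ Lc : ℕ, Lc = ⌊((E.N m : ℝ) / E.N (m + 1)) ^ (1 / 64 : ℝ) * (E.N (m + 1) * E.cellVisc (m + 1)) / Real.sqrt c⌋₊ →
          ∀ S : Torus.Visc4 (Fin 3), Torus.OddSmall S β → Torus.NearIso S lo hi →
            Torus.OddSmall (Φ (E.cellVisc (m + 1)) S) β → Torus.NearIso (Φ (E.cellVisc (m + 1)) S) lo hi →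
          ∀ Um Um1 : ℝ → ℝ → (V2 →L[ℝ] V2),
            Torus.IsPropagator 1 (fun (_ : ℝ) (_ : UnitAddTorus (Fin 3)) => (0 : EuclideanSpace ℝ (Fin 3)))
              (E.kbar m • renormStep (Φ (E.cellVisc (m + 1))) (E.gain / E.cellVisc (m + 1) ^ 2) S) Um →
            Torus.IsPropagator 1 (E.toFractalCarrierData.level (m + 1)) (E.kbar (m + 1) • S) Um1 →
          ∀ ηz ε : ℝ, ηz = Cz * ((E.N m : ℝ) / E.N (m + 1)) ^ σz →
            ε = ((E.N m : ℝ) / E.N (m + 1)) ^ σz * (1 - Real.exp (-(4 * Real.pi ^ 2 * (E.kbar m * lo)))) * E.refresh (m + 1) →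
          ∀ S : Finset (Fin 3 → ℤ), S = (Torus.freqBall (Lc / 2)).erase 0 →
          ∀ (j : ℕ) (s' : ℝ), (j : ℝ) * E.refresh (m + 1) + E.refresh (m + 1) ≤ s' →
            s' ≤ (j : ℝ) * E.refresh (m + 1) + 2 * E.refresh (m + 1) → s' ≤ 1 →
            ∀ x y : V2,
              (∀ k', k' ∉ S → UnitAddTorus.mFourierCoeff (EuclideanSpace.complexify ∘ ⇑(x)) k' = 0) →
              (∀ k', k' ∉ S → UnitAddTorus.mFourierCoeff (EuclideanSpace.complexify ∘ ⇑(y)) k' = 0) →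
              |⟪Um1 ((j : ℝ) * E.refresh (m + 1)) s' x - Um ((j : ℝ) * E.refresh (m + 1)) s' x, y⟫_ℝ| ≤ ηz
                * Real.sqrt (∑ k' ∈ S, min 1 ((E.a (m + 1) * (8 * Real.pi ^ 2 * ‖Torus.latticeVec k'‖ ^ 2 * lo * (E.cellVisc (m + 1) + c / E.cellVisc (m + 1)) / (E.N (m + 1) : ℝ) ^ 2)) * (s' - (j : ℝ) * E.refresh (m + 1))) * ‖UnitAddTorus.mFourierCoeff (EuclideanSpace.complexify ∘ ⇑(x)) k'‖ ^ 2)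
                * Real.sqrt (∑ k' ∈ S, min 1 ((E.a (m + 1) * (8 * Real.pi ^ 2 * ‖Torus.latticeVec k'‖ ^ 2 * lo * (E.cellVisc (m + 1) + c / E.cellVisc (m + 1)) / (E.N (m + 1) : ℝ) ^ 2)) * (s' - (j : ℝ) * E.refresh (m + 1))) * ‖UnitAddTorus.mFourierCoeff (EuclideanSpace.complexify ∘ ⇑(y)) k'‖ ^ 2) := by
  intro k W M hM c hc Φ lo hi Λ β σ C ν₀ K hlo hlo1 hhi hΛ hβ hσ hC hν₀ hK hV
  -- the bookkeeping constant and the exponent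
  set CZ : ℝ := (hi * Λ / lo) * C * (C * (1 + ((K + ν₀) / (2 * Real.sqrt c) + 1) ^ σ)
      + (2 * Real.pi ^ 2 * lo * (ν₀ ^ 2 / c + 1) * M * W.period + 1)) with hCZ_def
  have hWp : 0 < W.period := PermissibleCarrier.period_pos W
  have hCZ0 : 0 ≤ CZ := by
    have : 0 ≤ hi := hlo.le.trans (hlo1.trans hhi)
    positivity
  set q : ℝ := (K + ν₀) / Real.sqrt c + 2 with hq_def
  have hq0 : 0 < q := by positivity
  refine ⟨ν₀, hν₀, 1, one_pos, ⌈q ^ (64:ℕ)⌉₊ + 1, 1, one_pos, 2 * Real.sqrt 2 * CZ + 1, by positivity, min σ 2 / 64,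
    by have := lt_min hσ (by norm_num : (0:ℝ) < 2); positivity, ?_⟩
  intro E hdes hgain hnu0 hKE hLP hT1 hN2 hT2 hT3 hT4 hT5
  refine ⟨0, fun m _ => ?_⟩
  intro Lc hLc Ssh hSo hSn hΦSo hΦSn Um Um1 hUm hUm1 ηz ε hηz hε Sfin hS j s' h1 h2 h3 x y hxS hyS
  -- the level's numbers
  set ν : ℝ := E.cellVisc (m + 1) with hν_def
  set a : ℝ := E.a (m + 1) with ha_def
  set N : ℕ := E.N (m + 1) with hN_def
  set ρ : ℝ := (E.N m : ℝ) / E.N (m + 1) with hρ_def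
  set τ : ℝ := s' - (j : ℝ) * E.refresh (m + 1) with hτ_def
  have hν : 0 < ν := cellVisc_pos' E.toFractalCarrierData (m + 1)
  have ha : 0 < a := E.a_pos (m + 1)
  have hNpos : 0 < N := E.N_pos (m + 1)
  have hN : (0:ℝ) < N := by exact_mod_cast hNpos
  have hNm : (0:ℝ) < E.N m := by exact_mod_cast E.N_pos m
  have hρ0 : 0 < ρ := div_pos hNm hN
  have hρ1 : ρ ≤ 1 := rho_le_one (hN2 m)
  have hr := E.refresh_pos (m + 1)
  have hτr : E.refresh (m + 1) ≤ τ := by rw [hτ_def]; linarith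
  have hτ : 0 < τ := lt_of_lt_of_le hr hτr
  have h1' : (j : ℝ) * E.refresh (m + 1) < s' := by linarith
  -- regime: `ν < nu0 ≤ ν₀`
  have hνν₀ : ν < ν₀ := lt_of_lt_of_le (hLP.permissible.2.2.2.2.1 (m + 1) (by omega)) hnu0
  -- (T1): `ρ ≤ 1/Λ₀`, hence `ρ^{1/64} ≤ 1/q`
  have hΛ₀ : (q ^ (64:ℕ) : ℝ) < (⌈q ^ (64:ℕ)⌉₊ + 1 : ℕ) := by
    push_cast; exact (Nat.le_ceil _).trans_lt (by linarith)
  have hρΛ : ρ * ((⌈q ^ (64:ℕ)⌉₊ + 1 : ℕ) : ℝ) ≤ 1 := by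
    have h := hT1 m
    have h' : (((⌈q ^ (64:ℕ)⌉₊ + 1 : ℕ) : ℝ)) * (E.N m : ℝ) ≤ (E.N (m + 1) : ℝ) := by exact_mod_cast h
    rw [hρ_def, div_mul_eq_mul_div, div_le_one hN]
    linarith [mul_comm ((⌈q ^ (64:ℕ)⌉₊ + 1 : ℕ) : ℝ) (E.N m : ℝ)]
  have hρq : ρ ^ (1 / 64 : ℝ) * q ≤ 1 := by
    have hρ64 : ρ * q ^ (64:ℕ) ≤ 1 := by
      calc ρ * q ^ (64:ℕ) ≤ ρ * ((⌈q ^ (64:ℕ)⌉₊ + 1 : ℕ) : ℝ) := mul_le_mul_of_nonneg_left hΛ₀.le hρ0.le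
        _ ≤ 1 := hρΛ
    have h2 : (ρ * q ^ (64:ℕ)) ^ (1 / 64 : ℝ) ≤ 1 := Real.rpow_le_one (by positivity) hρ64 (by norm_num)
    rw [Real.mul_rpow hρ0.le (by positivity), ← Real.rpow_natCast q 64, ← Real.rpow_mul hq0.le] at h2
    norm_num at h2
    exact h2
  -- the trim level: `0 ≤ Lc ≤ ρ^{1/64} N ν/√c < N`
  have hsc : 0 < Real.sqrt c := Real.sqrt_pos.2 hc
  have hLcR : (Lc : ℝ) ≤ ρ ^ (1 / 64 : ℝ) * (N * ν) / Real.sqrt c := by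
    rw [hLc]; exact Nat.floor_le (by positivity)
  have hLcN' : (Lc : ℝ) < N := by
    have hkey : ρ ^ (1 / 64 : ℝ) * ν < Real.sqrt c := by
      -- `ρ^{1/64} ≤ 1/q` and `ν < ν₀ < q √c = K + ν₀ + 2√c`
      have h3' : ρ ^ (1 / 64 : ℝ) * ν * q ≤ ν :=
        calc ρ ^ (1 / 64 : ℝ) * ν * q = ν * (ρ ^ (1 / 64 : ℝ) * q) := by ring
          _ ≤ ν * 1 := mul_le_mul_of_nonneg_left hρq hν.le
          _ = ν := mul_one _
      have h4 : ν < Real.sqrt c * q := by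
        rw [hq_def, mul_add, mul_div_cancel₀ _ hsc.ne']; linarith [hK, hνν₀, hsc]
      have h5 : ρ ^ (1 / 64 : ℝ) * ν ≤ ν / q := by rw [le_div_iff₀ hq0]; exact h3'
      have h6 : ν / q < Real.sqrt c := by rw [div_lt_iff₀ hq0]; exact h4
      exact lt_of_le_of_lt h5 h6
    calc (Lc : ℝ) ≤ ρ ^ (1 / 64 : ℝ) * (N * ν) / Real.sqrt c := hLcR
      _ = N * (ρ ^ (1 / 64 : ℝ) * ν / Real.sqrt c) := by ring
      _ < N * 1 := mul_lt_mul_of_pos_left (by rw [div_lt_one hsc]; exact hkey) hN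
      _ = N := mul_one _
  have hLcN : 2 * (Lc / 2) < N := by
    have : Lc < N := by exact_mod_cast hLcN'
    omega
  have hhalf : ((Lc / 2 : ℕ) : ℝ) ≤ ρ ^ (1 / 64 : ℝ) * N * ν / (2 * Real.sqrt c) := by
    have h0 : ((Lc / 2 : ℕ) : ℝ) ≤ (Lc : ℝ) / 2 := by
      have : ((Lc / 2 : ℕ) : ℝ) * 2 ≤ Lc := by exact_mod_cast Nat.div_mul_le_self Lc 2
      linarith
    calc ((Lc / 2 : ℕ) : ℝ) ≤ (Lc : ℝ) / 2 := h0
      _ ≤ (ρ ^ (1 / 64 : ℝ) * (N * ν) / Real.sqrt c) / 2 := by linarith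
      _ = ρ ^ (1 / 64 : ℝ) * N * ν / (2 * Real.sqrt c) := by field_simp
  have hscale : ((Lc / 2 : ℕ) : ℝ) * (⌈K / E.cellVisc (m + 1)⌉₊ : ℝ) ≤ E.N (m + 1) := by
    have hceil : (⌈K / ν⌉₊ : ℝ) ≤ K / ν + 1 := (Nat.ceil_lt_add_one (by positivity)).le
    calc ((Lc / 2 : ℕ) : ℝ) * (⌈K / E.cellVisc (m + 1)⌉₊ : ℝ)
        ≤ (ρ ^ (1 / 64 : ℝ) * N * ν / (2 * Real.sqrt c)) * (K / ν + 1) := mul_le_mul hhalf hceil (Nat.cast_nonneg _) (by positivity)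
      _ = N * (ρ ^ (1 / 64 : ℝ) * (K + ν) / (2 * Real.sqrt c)) := by field_simp
      _ ≤ N * 1 := by
          refine mul_le_mul_of_nonneg_left ?_ hN.le
          rw [div_le_one (by positivity)]
          -- `ρ^{1/64}(K + ν) ≤ (K + ν₀)/q ≤ 2√c·(K+ν₀)/(K+ν₀+2√c) … ≤ 2√c`
          have hρinv : ρ ^ (1 / 64 : ℝ) ≤ 1 / q := by rw [le_div_iff₀ hq0]; exact hρq
          have h5 : ρ ^ (1 / 64 : ℝ) * (K + ν) ≤ (K + ν₀) / q :=
            calc ρ ^ (1 / 64 : ℝ) * (K + ν) ≤ ρ ^ (1 / 64 : ℝ) * (K + ν₀) :=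
                  mul_le_mul_of_nonneg_left (by linarith) (Real.rpow_pos_of_pos hρ0 _).le
              _ ≤ (1 / q) * (K + ν₀) := mul_le_mul_of_nonneg_right hρinv (by linarith)
              _ = (K + ν₀) / q := by ring
          have hq2 : 2 * Real.sqrt c * q = 2 * (K + ν₀) + 4 * Real.sqrt c := by
            rw [hq_def]; field_simp; ring
          have h6 : (K + ν₀) / q ≤ 2 * Real.sqrt c := by
            rw [div_le_iff₀ hq0, hq2]; linarith [hK, hν₀.le, hsc.le]
          linarith
      _ = E.N (m + 1) := mul_one _
  -- the window bound in (V)'s currency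
  have hwin := abs_inner_window_sub_le_sum E hLP hdes hgain m hV hΛ.le hlo (hlo1.trans hhi) hc hC hνν₀ hSo hSn hΦSn hUm hUm1
    Lc hLcN hscale j h1' h3 x y (by rw [← hS]; exact hxS) (by rw [← hS]; exact hyS)
  rw [← hS] at hwin
  refine hwin.trans ?_
  -- bookkeeping inputs
  have hνρ : ν ≤ ρ ^ (1 / 4 : ℝ) := by
    have h := hT2 m
    have e : ((E.N (m + 1) : ℝ) / E.N m) = ρ⁻¹ := by rw [hρ_def, inv_div]
    rw [e, Real.inv_rpow hρ0.le] at h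
    have hpos : 0 < ρ ^ (1 / 4 : ℝ) := Real.rpow_pos_of_pos hρ0 _
    calc ν = ν * (ρ ^ (1 / 4 : ℝ))⁻¹ * ρ ^ (1 / 4 : ℝ) := by field_simp
      _ ≤ 1 * ρ ^ (1 / 4 : ℝ) := mul_le_mul_of_nonneg_right h hpos.le
      _ = ρ ^ (1 / 4 : ℝ) := one_mul _
  have hP : M * W.period / ν = a * E.physPeriod (m + 1) := by
    rw [show E.physPeriod (m + 1) = E.toFractalCarrierData.physPeriod (m + 1) from rfl, physPeriod_eq E.toFractalCarrierData hdes (m + 1)]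
    rw [show E.toFractalCarrierData.cellVisc (m + 1) = ν from rfl, show E.toFractalCarrierData.a (m + 1) = a from rfl]
    field_simp
  have hτP : E.physPeriod (m + 1) ≤ ρ ^ (1 / 16 : ℝ) * τ := by
    have h := hT5 m
    have e : ((E.N (m + 1) : ℝ) / E.N m) = ρ⁻¹ := by rw [hρ_def, inv_div]
    rw [e, Real.inv_rpow hρ0.le] at h
    have hpos : 0 < ρ ^ (1 / 16 : ℝ) := Real.rpow_pos_of_pos hρ0 _
    calc E.physPeriod (m + 1) = ρ ^ (1 / 16 : ℝ) * ((ρ ^ (1 / 16 : ℝ))⁻¹ * E.physPeriod (m + 1)) := by field_simp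
      _ ≤ ρ ^ (1 / 16 : ℝ) * E.refresh (m + 1) := mul_le_mul_of_nonneg_left h hpos.le
      _ ≤ ρ ^ (1 / 16 : ℝ) * τ := mul_le_mul_of_nonneg_left hτr hpos.le
  -- termwise bookkeeping
  have hterm : ∀ ℓ ∈ Sfin,
      2 * Real.sqrt 2 * (C * (C * (E.cellVisc (m + 1) ^ σ + (‖Torus.latticeVec ℓ‖ * (⌈K / E.cellVisc (m + 1)⌉₊ : ℝ) / E.N (m + 1)) ^ σ)
              * min 1 ((8 * Real.pi ^ 2 * ‖Torus.latticeVec ℓ‖ ^ 2 * (hi * Λ) * (E.cellVisc (m + 1) + c / E.cellVisc (m + 1)) / (E.N (m + 1) : ℝ) ^ 2) * (E.a (m + 1) * (s' - (j : ℝ) * E.refresh (m + 1))))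
            + (8 * Real.pi ^ 2 * ‖Torus.latticeVec ℓ‖ ^ 2 * (hi * Λ) * (E.cellVisc (m + 1) + c / E.cellVisc (m + 1)) / (E.N (m + 1) : ℝ) ^ 2)
              * (M * W.period / E.cellVisc (m + 1))))
        ≤ ηz * min 1 ((E.a (m + 1) * (8 * Real.pi ^ 2 * ‖Torus.latticeVec ℓ‖ ^ 2 * lo * (E.cellVisc (m + 1) + c / E.cellVisc (m + 1)) / (E.N (m + 1) : ℝ) ^ 2)) * (s' - (j : ℝ) * E.refresh (m + 1))) := by
    intro ℓ hℓ
    rw [hS, Finset.mem_erase, Torus.mem_freqBall] at hℓ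
    have hnℓ : ‖Torus.latticeVec ℓ‖ ≤ ρ ^ (1 / 64 : ℝ) * N * ν / (2 * Real.sqrt c) := by
      have hsq : ‖Torus.latticeVec ℓ‖ ^ 2 ≤ (((Lc / 2 : ℕ) : ℝ)) ^ 2 := by rw [norm_latticeVec_sq']; exact hℓ.2
      exact ((pow_le_pow_iff_left₀ (norm_nonneg _) (Nat.cast_nonneg _) (by norm_num : (2:ℕ) ≠ 0)).1 hsq).trans hhalf
    have hb := errBound_le (C := C) (σ := σ) (ν := ν) (ν₀ := ν₀) (K := K) (c := c) (lo := lo) (hi := hi) (Λ := Λ) (M := M)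
      (Wp := W.period) (N := (N:ℝ)) (a := a) (τ := τ) (physP := E.physPeriod (m + 1)) (ρ := ρ) (nℓ := ‖Torus.latticeVec ℓ‖)
      hC hσ hν hνν₀.le hK.le hc hlo (hlo1.trans hhi) hΛ.le hM hWp hN ha hτ hρ0 hρ1 hνρ (norm_nonneg _) hnℓ hP hτP
    have hd0 : 0 ≤ min 1 (a * (8 * Real.pi ^ 2 * ‖Torus.latticeVec ℓ‖ ^ 2 * lo * (ν + c / ν) / (N:ℝ) ^ 2) * τ) := by
      have : 0 < ν + c / ν := by positivity
      exact le_min zero_le_one (by positivity)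
    have hρσ : 0 ≤ ρ ^ (min σ 2 / 64) := (Real.rpow_pos_of_pos hρ0 _).le
    calc 2 * Real.sqrt 2 * (C * (C * (ν ^ σ + (‖Torus.latticeVec ℓ‖ * (⌈K / ν⌉₊ : ℝ) / N) ^ σ)
              * min 1 ((8 * Real.pi ^ 2 * ‖Torus.latticeVec ℓ‖ ^ 2 * (hi * Λ) * (ν + c / ν) / (N:ℝ) ^ 2) * (a * τ))
            + (8 * Real.pi ^ 2 * ‖Torus.latticeVec ℓ‖ ^ 2 * (hi * Λ) * (ν + c / ν) / (N:ℝ) ^ 2) * (M * W.period / ν)))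
        ≤ 2 * Real.sqrt 2 * (CZ * ρ ^ (min σ 2 / 64) * min 1 (a * (8 * Real.pi ^ 2 * ‖Torus.latticeVec ℓ‖ ^ 2 * lo * (ν + c / ν) / (N:ℝ) ^ 2) * τ)) :=
          mul_le_mul_of_nonneg_left hb (by positivity)
      _ ≤ (2 * Real.sqrt 2 * CZ + 1) * ρ ^ (min σ 2 / 64) * min 1 (a * (8 * Real.pi ^ 2 * ‖Torus.latticeVec ℓ‖ ^ 2 * lo * (ν + c / ν) / (N:ℝ) ^ 2) * τ) := by
          have h0 := mul_nonneg hρσ hd0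
          calc 2 * Real.sqrt 2 * (CZ * ρ ^ (min σ 2 / 64) * min 1 (a * (8 * Real.pi ^ 2 * ‖Torus.latticeVec ℓ‖ ^ 2 * lo * (ν + c / ν) / (N:ℝ) ^ 2) * τ))
              = (2 * Real.sqrt 2 * CZ) * (ρ ^ (min σ 2 / 64) * min 1 (a * (8 * Real.pi ^ 2 * ‖Torus.latticeVec ℓ‖ ^ 2 * lo * (ν + c / ν) / (N:ℝ) ^ 2) * τ)) := by ring
            _ ≤ (2 * Real.sqrt 2 * CZ) * (ρ ^ (min σ 2 / 64) * min 1 (a * (8 * Real.pi ^ 2 * ‖Torus.latticeVec ℓ‖ ^ 2 * lo * (ν + c / ν) / (N:ℝ) ^ 2) * τ))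
                + ρ ^ (min σ 2 / 64) * min 1 (a * (8 * Real.pi ^ 2 * ‖Torus.latticeVec ℓ‖ ^ 2 * lo * (ν + c / ν) / (N:ℝ) ^ 2) * τ) := le_add_of_nonneg_right h0
            _ = (2 * Real.sqrt 2 * CZ + 1) * ρ ^ (min σ 2 / 64) * min 1 (a * (8 * Real.pi ^ 2 * ‖Torus.latticeVec ℓ‖ ^ 2 * lo * (ν + c / ν) / (N:ℝ) ^ 2) * τ) := by ring
      _ = ηz * min 1 (a * (8 * Real.pi ^ 2 * ‖Torus.latticeVec ℓ‖ ^ 2 * lo * (ν + c / ν) / (N:ℝ) ^ 2) * τ) := by rw [hηz]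
  -- sum and Cauchy–Schwarz
  have hηz0 : 0 ≤ ηz := by rw [hηz]; have := (Real.rpow_pos_of_pos hρ0 (min σ 2 / 64)).le; positivity
  calc ∑ ℓ ∈ Sfin, (2 * Real.sqrt 2 * (C * (C * (E.cellVisc (m + 1) ^ σ + (‖Torus.latticeVec ℓ‖ * (⌈K / E.cellVisc (m + 1)⌉₊ : ℝ) / E.N (m + 1)) ^ σ)
              * min 1 ((8 * Real.pi ^ 2 * ‖Torus.latticeVec ℓ‖ ^ 2 * (hi * Λ) * (E.cellVisc (m + 1) + c / E.cellVisc (m + 1)) / (E.N (m + 1) : ℝ) ^ 2) * (E.a (m + 1) * (s' - (j : ℝ) * E.refresh (m + 1))))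
            + (8 * Real.pi ^ 2 * ‖Torus.latticeVec ℓ‖ ^ 2 * (hi * Λ) * (E.cellVisc (m + 1) + c / E.cellVisc (m + 1)) / (E.N (m + 1) : ℝ) ^ 2)
              * (M * W.period / E.cellVisc (m + 1)))))
          * ‖mFourierCoeff (EuclideanSpace.complexify ∘ ⇑x) ℓ‖ * ‖mFourierCoeff (EuclideanSpace.complexify ∘ ⇑y) ℓ‖
      ≤ ∑ ℓ ∈ Sfin, ηz * min 1 ((E.a (m + 1) * (8 * Real.pi ^ 2 * ‖Torus.latticeVec ℓ‖ ^ 2 * lo * (E.cellVisc (m + 1) + c / E.cellVisc (m + 1)) / (E.N (m + 1) : ℝ) ^ 2)) * (s' - (j : ℝ) * E.refresh (m + 1)))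
          * ‖mFourierCoeff (EuclideanSpace.complexify ∘ ⇑x) ℓ‖ * ‖mFourierCoeff (EuclideanSpace.complexify ∘ ⇑y) ℓ‖ := by
        refine Finset.sum_le_sum fun ℓ hℓ => ?_
        exact mul_le_mul_of_nonneg_right (mul_le_mul_of_nonneg_right (hterm ℓ hℓ) (norm_nonneg _)) (norm_nonneg _)
    _ ≤ ηz * Real.sqrt (∑ k' ∈ Sfin, min 1 ((E.a (m + 1) * (8 * Real.pi ^ 2 * ‖Torus.latticeVec k'‖ ^ 2 * lo * (E.cellVisc (m + 1) + c / E.cellVisc (m + 1)) / (E.N (m + 1) : ℝ) ^ 2)) * (s' - (j : ℝ) * E.refresh (m + 1))) * ‖mFourierCoeff (EuclideanSpace.complexify ∘ ⇑x) k'‖ ^ 2)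
          * Real.sqrt (∑ k' ∈ Sfin, min 1 ((E.a (m + 1) * (8 * Real.pi ^ 2 * ‖Torus.latticeVec k'‖ ^ 2 * lo * (E.cellVisc (m + 1) + c / E.cellVisc (m + 1)) / (E.N (m + 1) : ℝ) ^ 2)) * (s' - (j : ℝ) * E.refresh (m + 1))) * ‖mFourierCoeff (EuclideanSpace.complexify ∘ ⇑y) k'‖ ^ 2) :=
        sum_weight_mul_le_sqrt Sfin _ _ _ ηz hηz0 (fun k' => le_min zero_le_one (by
          have : 0 < ν + c / ν := by positivity
          have hτ0 : 0 ≤ s' - (j : ℝ) * E.refresh (m + 1) := hτ.le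
          positivity))

end Summit.AnomalousDissipation.AnomalousDissipation.Theorems.SolenoidalFractalHomogenisation.LagrangianStep.FlatWindow

end
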